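import Mathlib
import Summits.Ventures.LatticeQCDFlow.Scaling.GroupSlabCost
import Summits.Ventures.LatticeQCDFlow.Scaling.LayerGirth

/-!
# LatticeQCDFlow / Scaling — slab moments for a general compact gauge group: the vertical Haar
# integral of a word of lateral plaquettes, and constancy of the moments below order four

HONEST FRAMING: exact (Metropolis-corrected) sampling algorithms for lattice gauge theory;
figures of merit are autocorrelation/cost numbers at stated couplings and volumes; no
continuum-physics claim.

Venture `LatticeQCDFlow` (cell pub-lqcd), topic `Scaling`, FANOUT row 30 (lean-1) — OUR WORK, file
4 of the extension of the slab-chain proof of (LC)/(U′) to a general compact gauge group `G` with a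
matrix representation `ρ` carrying one-link data `OneLink ρ θ` (`Scaling/GroupLayerHaar.lean`).
The LOW-MOMENT half of the moment hypothesis `SlabChain.Moments` (`g = 4`) for the slab cost
`slabCostG ρ` (`Scaling/GroupSlabCost.lean`):
* `plaqG_mulSingle_*` — how the lateral plaquette through `ℓ` changes when ONE vertical bond `y` is
  multiplied by `g`: not at all if `ℓ` does not touch `y`, by `g` on the left if `y = src ℓ`, by an
  inserted `g⁻¹` if `y = tgt ℓ`;
* **`integral_word_eq_zero_of_lonely`** — the vertical integral of a word
  `∏_k Re tr ρ(plaqG (w k))` VANISHES as soon as some vertical bond is touched by exactly one letter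
  (average that bond: `∫ Re tr ρ(g P) dg = 0 = ∫ Re tr ρ(A g⁻¹ B) dg`, `OneLink.integral_trRe`);
* **`integral_word_const`** — a single plaquette repeated `m` times integrates to the `m`-th moment
  `kappaG ρ m = ∫ (Re tr ρ)^m dHaar` (average its source bond; right invariance);
* **`integral_slabCostG_pow_eq_const`** — for side `L ≥ 4` and `m ≤ 3` the vertical moment
  `∫ slabCostG(e,v,e')^m dv` is the constant `momentConstG ρ m = #{constant words} · kappaG ρ m`,
  by the girth lemma in bond form (`U1Layer.exists_lonely_of_not_const`, `Scaling/LayerGirth.lean`).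
With `Scaling/GroupSlabCost.lean` (order four, centring) this is the full moment hypothesis for any
compact `G`; the eigenvalue is the sequel.  Elementary [cite: MontvayMunster1994, §3.6.2]; nothing is
cited as a fact; `def`s `kappaG`, `momentConstG`; no `sorry`.
-/

noncomputable section

open MeasureTheory Filter Finset
open Literature.MathematicalPhysics.QuantumFieldTheory
open Summit.Ventures.LatticeQCDFlow.Theory2.Lattice.U1Layer (LSite LEdge exists_lonely_of_not_const)

namespace Summit.Ventures.LatticeQCDFlow.Theory2.GroupLayer

variable {G : Type*} [Group G] [TopologicalSpace G] [IsTopologicalGroup G] [CompactSpace G]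
  [MeasurableSpace G] [BorelSpace G]
variable {d L : ℕ} [NeZero L] {a : Fin d} {N : ℕ} {ρ : G →* Matrix (Fin N) (Fin N) ℂ} {θ : ℝ}

/-! ## 1. One vertical bond multiplied by `g` -/

omit [TopologicalSpace G] [IsTopologicalGroup G] [CompactSpace G] [MeasurableSpace G] [BorelSpace G]
  [NeZero L] in
/-- A lateral plaquette not touching `y` does not see the bond `y`. [folklore] -/
theorem plaqG_mulSingle_of_not_touches {ℓ : LEdge d L a} {y : LSite d L a} (hy : ¬ ℓ.Touches y)
    (g : G) (e : LEdge d L a → G) (v : LSite d L a → G) (e' : LEdge d L a → G) :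
    plaqG e ((Pi.mulSingle y g : LSite d L a → G) * v) e' ℓ = plaqG e v e' ℓ := by
  have hs : ℓ.src ≠ y := fun h => hy (Or.inl h)
  have ht : ℓ.tgt ≠ y := fun h => hy (Or.inr h)
  simp only [plaqG, mulSingle_mul_apply_ne hs, mulSingle_mul_apply_ne ht]

omit [TopologicalSpace G] [IsTopologicalGroup G] [CompactSpace G] [MeasurableSpace G] [BorelSpace G] in
/-- Multiplying the source bond by `g` multiplies the plaquette by `g` on the left. [folklore] -/
theorem plaqG_mulSingle_src (hL : 2 ≤ L) (ℓ : LEdge d L a) (g : G) (e : LEdge d L a → G)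
    (v : LSite d L a → G) (e' : LEdge d L a → G) :
    plaqG e ((Pi.mulSingle ℓ.src g : LSite d L a → G) * v) e' ℓ = 1 * g * plaqG e v e' ℓ := by
  simp only [plaqG, mulSingle_mul_apply_same, mulSingle_mul_apply_ne (LEdge.tgt_ne_src hL ℓ),
    one_mul, mul_assoc]

omit [TopologicalSpace G] [IsTopologicalGroup G] [CompactSpace G] [MeasurableSpace G] [BorelSpace G] in
/-- Multiplying the target bond by `g` inserts `g⁻¹`. [folklore] -/
theorem plaqG_mulSingle_tgt (hL : 2 ≤ L) (ℓ : LEdge d L a) (g : G) (e : LEdge d L a → G)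
    (v : LSite d L a → G) (e' : LEdge d L a → G) :
    plaqG e ((Pi.mulSingle ℓ.tgt g : LSite d L a → G) * v) e' ℓ =
      (v ℓ.src * e ℓ * (v ℓ.tgt)⁻¹) * g⁻¹ * (e' ℓ)⁻¹ := by
  simp only [plaqG, mulSingle_mul_apply_same, mulSingle_mul_apply_ne (LEdge.tgt_ne_src hL ℓ).symm,
    mul_inv_rev, mul_assoc]

/-! ## 2. The vertical integral of a word -/

section Words

variable [SecondCountableTopology G]

omit [CompactSpace G] [MeasurableSpace G] [BorelSpace G] [SecondCountableTopology G] [NeZero L] in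
/-- A word of lateral plaquettes is a continuous function of the vertical bonds. [folklore] -/
theorem continuous_word (hρ : Continuous ρ) {m : ℕ} (w : Fin m → LEdge d L a) (e e' : LEdge d L a → G) :
    Continuous fun v : LSite d L a → G => ∏ k, (trRe ρ (plaqG e v e' (w k)) : ℂ) := by
  refine continuous_finsetProd _ fun k _ => Complex.continuous_ofReal.comp
    ((continuous_trRe ρ hρ).comp ?_)
  exact (continuous_plaqG (w k)).comp (continuous_const.prodMk (continuous_id.prodMk continuous_const))

omit [IsTopologicalGroup G] [MeasurableSpace G] [BorelSpace G] [SecondCountableTopology G]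
  [NeZero L] in
/-- A word of `m` lateral plaquettes is bounded by `trReBound^m`. [folklore] -/
theorem norm_word_le (hρ : Continuous ρ) {m : ℕ} (w : Fin m → LEdge d L a) (e e' : LEdge d L a → G)
    (v : LSite d L a → G) :
    ‖∏ k, (trRe ρ (plaqG e v e' (w k)) : ℂ)‖ ≤ trReBound (G := G) (ρ := ρ) hρ ^ m := by
  rw [norm_prod]
  calc ∏ k, ‖(trRe ρ (plaqG e v e' (w k)) : ℂ)‖ ≤ ∏ _k : Fin m, trReBound (G := G) (ρ := ρ) hρ :=
        prod_le_prod (fun _ _ => norm_nonneg _) fun k _ => by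
          rw [Complex.norm_real, Real.norm_eq_abs]; exact abs_trRe_le hρ _
    _ = trReBound (G := G) (ρ := ρ) hρ ^ m := by simp

/-- **A word with a lonely vertical bond integrates to zero.**  If the layer site `y` is touched
by the letter `k₀` of `w` and by no other letter, then `∫ ∏_k Re tr ρ(plaqG e v e' (w k)) dv = 0`.
[folklore] -/
theorem integral_word_eq_zero_of_lonely (h : OneLink ρ θ) (hL : 2 ≤ L) {m : ℕ}
    (w : Fin m → LEdge d L a) (k₀ : Fin m) (y : LSite d L a) (hk₀ : (w k₀).Touches y)
    (hother : ∀ k, k ≠ k₀ → ¬ (w k).Touches y) (e e' : LEdge d L a → G) :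
    ∫ v, ∏ k, (trRe ρ (plaqG e v e' (w k)) : ℂ)
      ∂(Measure.pi fun _ : LSite d L a => haarProbability G) = 0 := by
  refine integral_pi_eq_of_average_eq y (continuous_word h.cont w e e').measurable
    (norm_word_le h.cont w e e') fun v => ?_
  -- split off the letter `k₀`; the others do not see the bond `y`
  have hsplit : ∀ g : G, ∏ k, (trRe ρ (plaqG e ((Pi.mulSingle y g : LSite d L a → G) * v) e' (w k)) : ℂ)
      = (trRe ρ (plaqG e ((Pi.mulSingle y g : LSite d L a → G) * v) e' (w k₀)) : ℂ) *
        ∏ k ∈ univ.erase k₀, (trRe ρ (plaqG e v e' (w k)) : ℂ) := by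
    intro g
    rw [← Finset.mul_prod_erase _ _ (mem_univ k₀)]
    congr 1
    exact prod_congr rfl fun k hk =>
      by rw [plaqG_mulSingle_of_not_touches (hother k (ne_of_mem_erase hk))]
  simp_rw [hsplit]
  rw [integral_mul_const]
  -- the lonely letter averages to zero
  have h0 : ∫ g, (trRe ρ (plaqG e ((Pi.mulSingle y g : LSite d L a → G) * v) e' (w k₀)) : ℂ)
      ∂haarProbability G = 0 := by
    rcases hk₀ with hs | ht
    · have hw : ∀ g : G, plaqG e ((Pi.mulSingle y g : LSite d L a → G) * v) e' (w k₀) =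
          1 * g * plaqG e v e' (w k₀) := fun g => by rw [← hs]; exact plaqG_mulSingle_src hL _ g e v e'
      simp_rw [hw]
      exact integral_trRe_mul h 1 _
    · have hw : ∀ g : G, plaqG e ((Pi.mulSingle y g : LSite d L a → G) * v) e' (w k₀) =
          (v (w k₀).src * e (w k₀) * (v (w k₀).tgt)⁻¹) * g⁻¹ * (e' (w k₀))⁻¹ := fun g => by
        rw [← ht]; exact plaqG_mulSingle_tgt hL _ g e v e'
      simp_rw [hw]
      exact integral_trRe_mul_inv h _ _
  rw [h0, zero_mul]

/-- The `m`-th moment of the character, `kappaG ρ m = ∫ (Re tr ρ)^m dHaar`. [folklore] -/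
def kappaG (ρ : G →* Matrix (Fin N) (Fin N) ℂ) (m : ℕ) : ℂ :=
  ∫ g, (trRe ρ g : ℂ) ^ m ∂haarProbability G

/-- **A repeated plaquette integrates to the `m`-th moment of the character**:
`∫ (Re tr ρ(plaqG e v e' ℓ₀))^m dv = kappaG ρ m`. [folklore] -/
theorem integral_word_const (hρ : Continuous ρ) (hL : 2 ≤ L) (ℓ₀ : LEdge d L a) (m : ℕ)
    (e e' : LEdge d L a → G) :
    ∫ v, ∏ _k : Fin m, (trRe ρ (plaqG e v e' ℓ₀) : ℂ)
      ∂(Measure.pi fun _ : LSite d L a => haarProbability G) = kappaG ρ m := by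
  refine integral_pi_eq_of_average_eq ℓ₀.src (continuous_word hρ (fun _ => ℓ₀) e e').measurable
    (norm_word_le hρ (fun _ => ℓ₀) e e') fun v => ?_
  simp_rw [prod_const, card_univ, Fintype.card_fin, plaqG_mulSingle_src hL ℓ₀, one_mul]
  exact integral_mul_right_eq_self (μ := haarProbability G) (fun g : G => (trRe ρ g : ℂ) ^ m) _

/-! ## 3. Below order four the vertical moments are constant -/

/-- The constant value of the vertical moment of order `m ≤ 3`: the number of constant words times
the `m`-th moment of the character. [folklore] -/
def momentConstG (ρ : G →* Matrix (Fin N) (Fin N) ℂ) (d L : ℕ) [NeZero L] (a : Fin d) (m : ℕ) : ℂ :=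
  ((univ.filter fun w : Fin m → LEdge d L a => ∀ k k', w k = w k').card : ℂ) * kappaG ρ m

/-- The vertical integral of a single word: `kappaG ρ m` for a constant word, `0` otherwise
(`L ≥ 4`, `m ≤ 3`). [folklore] -/
theorem integral_word (h : OneLink ρ θ) (hL : 4 ≤ L) {m : ℕ} (hm : m ≤ 3) (w : Fin m → LEdge d L a)
    (e e' : LEdge d L a → G) :
    ∫ v, ∏ k, (trRe ρ (plaqG e v e' (w k)) : ℂ) ∂(Measure.pi fun _ : LSite d L a => haarProbability G)
      = if (∀ k k', w k = w k') then kappaG ρ m else 0 := by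
  split_ifs with hw
  · -- a constant word
    rcases Nat.eq_zero_or_pos m with rfl | hmpos
    · simp only [Finset.univ_eq_empty, Finset.prod_empty, kappaG, pow_zero, integral_const,
        probReal_univ, one_smul]
    · set k₀ : Fin m := ⟨0, hmpos⟩
      have hc : ∀ v : LSite d L a → G, ∏ k, (trRe ρ (plaqG e v e' (w k)) : ℂ) =
          ∏ _k : Fin m, (trRe ρ (plaqG e v e' (w k₀)) : ℂ) := fun v =>
        prod_congr rfl fun k _ => by rw [hw k k₀]
      simp_rw [hc]
      exact integral_word_const h.cont (by omega) (w k₀) m e e'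
  · obtain ⟨k, y, hky, hother⟩ := exists_lonely_of_not_const hL hm w hw
    exact integral_word_eq_zero_of_lonely h (by omega) w k y hky hother e e'

/-- **Below order four the vertical moments are constant** (side `L ≥ 4`, the girth of the layer):
`∫ slabCostG(e, v, e')^m dv = momentConstG ρ m` for `m ≤ 3`. [folklore] -/
theorem integral_slabCostG_pow_eq_const (h : OneLink ρ θ) (hL : 4 ≤ L) {m : ℕ} (hm : m ≤ 3)
    (e e' : LEdge d L a → G) :
    ∫ v, ((slabCostG ρ e v e' : ℝ) : ℂ) ^ m ∂(Measure.pi fun _ : LSite d L a => haarProbability G) =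
      momentConstG ρ d L a m := by
  simp_rw [slabCostG_pow_eq_sum]
  have hint : ∀ w : Fin m → LEdge d L a, Integrable
      (fun v : LSite d L a → G => ∏ k, (trRe ρ (plaqG e v e' (w k)) : ℂ))
      (Measure.pi fun _ : LSite d L a => haarProbability G) := fun w =>
    Integrable.of_bound (continuous_word h.cont w e e').measurable.aestronglyMeasurable _
      (Eventually.of_forall (norm_word_le h.cont w e e'))
  rw [integral_finsetSum _ fun w _ => hint w]
  simp_rw [integral_word h hL hm]
  rw [Finset.sum_ite, sum_const_zero, add_zero, sum_const, nsmul_eq_mul, momentConstG]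

end Words

end Summit.Ventures.LatticeQCDFlow.Theory2.GroupLayer

end
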